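import Mathlib
import HarnessLib
import Summits.HubbardSuperconductivity.HubbardSuperconductivity.Theorems.KLProgrammePerturbedFermiCurveCausticHessian

/-!
# Route `KLProgramme` — ENGINE child (stmt-HubbardSuperconductivity-20437 `KLRegimeEngineV17F2`): the caustic second variation ON THE FRAME CURVE and the
# `N`-uniform acceleration bound (step (T2)-caustic; design note HOME/hubbard-kl-k3c2-p2/TWO-SHELL-FRAME-PORT.md §6–§8)

Cell `gate-hubbard-kl`, seat hubbard-kl-k3c2-p2 g15.  Specialisation of `caustic_second_variation_ge` (`…CausticHessian`) to the frame's Fermi curve: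
* **`caustic_second_variation_frame_ge`** — for a root selection `u` of `ε₀ + δ_K = ν` (`δ_K = −K.eval`, tangent `v = (X_E′, Y_E′)`, acceleration `a`), a transfer `w⃗`
  and an angle at which `2p(θ) − w⃗` is `ρ`-close to `2πm` (sup-norm) with `|ν − μ| + Kc√2ρ < r₀`:
  `D²e_K(q)[v,v] + De_K(q)[a] ≥ 2w(X_E′² + Y_E′²) − ((w + Kc)(γS/g₀)² + 2Kc·S·γS/g₀ + γ‖toLp a‖)`, `q = p(θ) − w⃗`, `γ = Kc√2ρ`, `S = ‖toLp v‖`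
  (this is `G″(θ)` for `G(θ) = E(p(θ) − w⃗)` by `fderiv_frameLevel_toLp` / `hessQuad_frameLevel_toLp`); inputs: `levelIdentity_one/two`, `hessFloor_of_geomConstants`,
  the reflection symmetry `frameLevel_toLp_reflect` / `fderiv_frameLevel_toLp_reflect` and the two mean-value bounds;
* **`norm_toLp_accel_le`** (`‖toLp a‖ ≤ |u″| + 2|u′| + u`) and **`abs_second_deriv_le_of_geomConstants`** — p4's `abs_second_deriv_le` with the `C²` size of `δ_K`
  replaced by the GLOBAL `‖D²e_K‖ ≤ Kc` (so `N`-uniform under `FrameOK`): `|u″| ≤ (2Kc·S_E² + (8 + 2κ₁)U₁ + (4 + κ₁)π√2)/(Dt_min − κ₁)`.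
Everything is PROVED; no definitions, no named facts; nothing asserts any stub or superconductivity.
References: DECOMP App. E Lemma E.3; FST II Lemma 2.1 [cite: FeldmanSalmhoferTrubowitz1998]; BGM 2006 §2.4 (2.41) [cite: BenfattoGiulianiMastropietro2006].
-/

noncomputable section

namespace Summit.HubbardSuperconductivity.HubbardSuperconductivity.Theorems.PerturbedFermiCurve

set_option linter.dupNamespace false -- summit = problem name (single-conjunct summit), D-0017

open Real Set
open Literature.MathematicalPhysics.QuantumLattice Literature.MathematicalPhysics.QuantumLattice.BandSectorCounting
open Literature.MathematicalPhysics.QuantumLattice.FermiRG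
open Summit.HubbardSuperconductivity.HubbardSuperconductivity.Theorems.DispersionFlow
open Summit.HubbardSuperconductivity.HubbardSuperconductivity.Theorems.KLRegimeSplit

/-! ## The caustic second variation on the frame curve and the `N`-uniform acceleration bound -/

section Root

variable {a b : ℝ} (B : BandBounds a b) {K : TrigPolyC4v} {κ₀ κ₁ ν : ℝ}
  (hδ : ∀ k : Fin 2 → ℝ, (∀ i, |k i| ≤ π) → |(fun k : Fin 2 → ℝ => -K.eval k) k| ≤ κ₀) (hlo : a ≤ ν - κ₀) (hhi : ν + κ₀ ≤ b)
  (hκ : ∀ k : Fin 2 → ℝ, (∀ i, |k i| ≤ π) → ‖fderiv ℝ (fun k : Fin 2 → ℝ => -K.eval k) k‖ ≤ κ₁) (hκ₁ : κ₁ < B.Dtmin)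
  {u : ℝ → ℝ} (hu : ∀ θ, IsBandFermiRadius (ν - (fun k : Fin 2 → ℝ => -K.eval k) (u θ • dir θ)) θ (u θ))
  {μ Kc r₀ g₀ w : ℝ} (hG : GeomConstants (frameLevel μ K) Kc r₀ g₀ w) (hν : |ν - μ| < r₀)
include B hδ hlo hhi hκ hκ₁ hu hG hν

/-- **Caustic second variation on the frame curve.**  For a root selection `u` of `ε₀ + δ_K = ν` (tangent `v = (X_E′, Y_E′)`, acceleration `a`), a transfer `w⃗`
and an angle `θ` at which `2p(θ) − w⃗` is `ρ`-close to `2πm` in sup-norm, with `|ν − μ| + Kc√2ρ < r₀`: the second variation of the frame band at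
`q = p(θ) − w⃗` along `(v, a)` is `≥ 2w(X_E′² + Y_E′²) − ((w + Kc)(γS/g₀)² + 2Kc·S·(γS/g₀) + γ‖toLp a‖)`, `γ = Kc√2ρ`, `S = ‖toLp v‖`
(it equals `G″(θ)` for `G(θ) = E(p(θ) − w⃗)`, `fderiv_frameLevel_toLp` / `hessQuad_frameLevel_toLp`). [cite: FeldmanSalmhoferTrubowitz1998, Lemma 2.1] -/
theorem caustic_second_variation_frame_ge (θ : ℝ) (wv : Fin 2 → ℝ) (m : Fin 2 → ℤ) {ρ : ℝ}
    (hwin : ∀ i, |2 * (u θ • dir θ) i - wv i - m i * (2 * π)| ≤ ρ) (hνρ : |ν - μ| + Kc * (Real.sqrt 2 * ρ) < r₀) :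
    2 * w * (VXE u θ ^ 2 + VYE u θ ^ 2) -
        ((w + Kc) * (Kc * (Real.sqrt 2 * ρ) * ‖(WithLp.toLp 2 ![VXE u θ, VYE u θ] : Momentum)‖ / g₀) ^ 2 +
          2 * Kc * ‖(WithLp.toLp 2 ![VXE u θ, VYE u θ] : Momentum)‖ *
            (Kc * (Real.sqrt 2 * ρ) * ‖(WithLp.toLp 2 ![VXE u θ, VYE u θ] : Momentum)‖ / g₀) +
          Kc * (Real.sqrt 2 * ρ) *
            ‖(WithLp.toLp 2 ![deriv (deriv u) θ * Real.cos θ - 2 * deriv u θ * Real.sin θ - u θ * Real.cos θ,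
                deriv (deriv u) θ * Real.sin θ + 2 * deriv u θ * Real.cos θ - u θ * Real.sin θ] : Momentum)‖) ≤
      fderiv ℝ (fderiv ℝ (frameLevel μ K)) (WithLp.toLp 2 (u θ • dir θ - wv)) (WithLp.toLp 2 ![VXE u θ, VYE u θ])
          (WithLp.toLp 2 ![VXE u θ, VYE u θ]) +
        fderiv ℝ (frameLevel μ K) (WithLp.toLp 2 (u θ • dir θ - wv))
          (WithLp.toLp 2 ![deriv (deriv u) θ * Real.cos θ - 2 * deriv u θ * Real.sin θ - u θ * Real.cos θ,
            deriv (deriv u) θ * Real.sin θ + 2 * deriv u θ * Real.cos θ - u θ * Real.sin θ]) := by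
  set δK : (Fin 2 → ℝ) → ℝ := fun k : Fin 2 → ℝ => -K.eval k with hδK
  set f := frameLevel μ K with hf
  set p : Fin 2 → ℝ := u θ • dir θ with hp
  set v : Fin 2 → ℝ := ![VXE u θ, VYE u θ] with hv
  set acc : Fin 2 → ℝ := ![deriv (deriv u) θ * Real.cos θ - 2 * deriv u θ * Real.sin θ - u θ * Real.cos θ,
    deriv (deriv u) θ * Real.sin θ + 2 * deriv u θ * Real.cos θ - u θ * Real.sin θ] with hacc
  set e : Fin 2 → ℝ := fun i => 2 * p i - wv i - m i * (2 * π) with he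
  set P : Momentum := WithLp.toLp 2 p with hP
  set V : Momentum := WithLp.toLp 2 v with hV
  set A : Momentum := WithLp.toLp 2 acc with hA
  set E : Momentum := WithLp.toLp 2 e with hE
  have hδs : ContDiff ℝ 2 δK := contDiff_frameShift_toLp K
  have h2ne : (2 : WithTop ℕ∞) ≠ 0 := by norm_num
  have hu2 : ContDiff ℝ 2 u := contDiff_of_isRoot B hδs h2ne hδ hlo hhi hκ hκ₁ hu
  have hroot : ∀ ϑ, sqDispersion (u ϑ • dir ϑ) + -K.eval (u ϑ • dir ϑ) = ν := fun ϑ =>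
    ((isBandFermiRadius_shifted_iff δK ν ϑ (u ϑ)).1 (hu ϑ)).2
  have hKc : 0 ≤ Kc := le_trans (norm_nonneg _) (hG.norm_iteratedFDeriv_le P 0 (by norm_num))
  have hp0 : p 0 = XE u θ := by simp [hp, dir, XE]
  have hp1 : p 1 = YE u θ := by simp [hp, dir, YE]
  have hv0 : v 0 = VXE u θ := by simp [hv]
  have hv1 : v 1 = VYE u θ := by simp [hv]
  have ha0 : acc 0 = deriv (deriv u) θ * Real.cos θ - 2 * deriv u θ * Real.sin θ - u θ * Real.cos θ := by simp [hacc]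
  have ha1 : acc 1 = deriv (deriv u) θ * Real.sin θ + 2 * deriv u θ * Real.cos θ - u θ * Real.sin θ := by simp [hacc]
  -- the level identities at `P` in `Momentum` form
  have hDer : ∀ z : Fin 2 → ℝ, fderiv ℝ f P (WithLp.toLp 2 z) = 2 * Real.sin (p 0) * z 0 + 2 * Real.sin (p 1) * z 1 + fderiv ℝ δK p z :=
    fun z => by rw [hf, hP, fderiv_frameLevel_toLp]
  have hHess : fderiv ℝ (fderiv ℝ f) P V V = 2 * Real.cos (p 0) * v 0 ^ 2 + 2 * Real.cos (p 1) * v 1 ^ 2 + fderiv ℝ (fderiv ℝ δK) p v v := by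
    have h := hessQuad_frameLevel_toLp μ K p v
    rw [hessQuad, iteratedFDeriv_two_apply] at h
    simpa only [Matrix.cons_val_zero, Matrix.cons_val_one] using h
  have hPV : fderiv ℝ f P V = 0 := by
    rw [hV, hDer, hp0, hp1, hv0, hv1]
    have h := levelIdentity_one hδs hu2 hroot θ
    rw [← hp, ← hv] at h
    exact h
  have hV2 : ‖V‖ ^ 2 = VXE u θ ^ 2 + VYE u θ ^ 2 := by
    rw [hV, EuclideanSpace.norm_eq, Real.sq_sqrt (Finset.sum_nonneg fun i _ => sq_nonneg _), Fin.sum_univ_two]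
    simp only [Real.norm_eq_abs, sq_abs, hv0, hv1]
  have hfloorP : w * ‖V‖ ^ 2 ≤ fderiv ℝ (fderiv ℝ f) P V V := by
    rw [hV2, hHess, hp0, hp1, hv0, hv1]
    have h := hessFloor_of_geomConstants hG hu2 hroot hν θ
    rw [← hp, ← hv] at h
    exact h
  have hid : fderiv ℝ (fderiv ℝ f) P V V + fderiv ℝ f P A = 0 := by
    rw [hHess, hA, hDer, hp0, hp1, hv0, hv1, ha0, ha1]
    have h := levelIdentity_two hδs hu2 hroot θ
    rw [← hp, ← hv] at h
    linarith [h]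
  -- the window: `q = −(p − e) + 2πm`, `‖E‖ ≤ √2ρ`
  have hq : u θ • dir θ - wv = fun i => -(p - e) i + m i * (2 * π) := by
    funext i
    simp only [he, Pi.sub_apply, hp]
    ring
  have hE0 : ∀ i, |e i| ≤ ρ := fun i => by
    have h := hwin i
    simp only [he, hp]
    exact h
  have hρ0 : 0 ≤ ρ := (abs_nonneg _).trans (hE0 0)
  have hEn : ‖E‖ ≤ Real.sqrt 2 * ρ := by
    have hsq : ‖E‖ ^ 2 = e 0 ^ 2 + e 1 ^ 2 := by
      rw [hE, EuclideanSpace.norm_eq, Real.sq_sqrt (Finset.sum_nonneg fun i _ => sq_nonneg _), Fin.sum_univ_two]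
      simp only [Real.norm_eq_abs, sq_abs]
    have h0 : e 0 ^ 2 ≤ ρ ^ 2 := by have := hE0 0; rw [← sq_abs]; exact pow_le_pow_left₀ (abs_nonneg _) this 2
    have h1 : e 1 ^ 2 ≤ ρ ^ 2 := by have := hE0 1; rw [← sq_abs]; exact pow_le_pow_left₀ (abs_nonneg _) this 2
    have h2 : (Real.sqrt 2 * ρ) ^ 2 = 2 * ρ ^ 2 := by rw [mul_pow, Real.sq_sqrt (by norm_num : (0:ℝ) ≤ 2)]
    have hle : ‖E‖ ^ 2 ≤ (Real.sqrt 2 * ρ) ^ 2 := by rw [hsq, h2]; linarith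
    exact (pow_le_pow_iff_left₀ (norm_nonneg E) (by positivity) two_ne_zero).1 hle
  have hPE : (WithLp.toLp 2 (p - e) : Momentum) = P - E := by rw [hP, hE, WithLp.toLp_sub]
  have hfP : f P = ν - μ := by rw [hf, hP, frameLevel_toLp, frameShift_toLp, hroot θ]
  -- `|f Q| < r₀`
  have hfQ : f (WithLp.toLp 2 (u θ • dir θ - wv)) = f (WithLp.toLp 2 (p - e)) := by
    rw [hq, hf, frameLevel_toLp_reflect]
  have hQ : |f (WithLp.toLp 2 (u θ • dir θ - wv))| < r₀ := by
    rw [hfQ, hPE]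
    have h1 : |f (P - E) - f P| ≤ Kc * ‖(P - E) - P‖ := abs_frameLevel_sub_le hG P (P - E)
    rw [show (P - E) - P = -E by abel, norm_neg] at h1
    have h2 : Kc * ‖E‖ ≤ Kc * (Real.sqrt 2 * ρ) := mul_le_mul_of_nonneg_left hEn hKc
    have h3 : |f (P - E)| ≤ |f (P - E) - f P| + |f P| := by
      have h := abs_add_le (f (P - E) - f P) (f P)
      rwa [sub_add_cancel] at h
    have h4 : |f P| = |ν - μ| := by rw [hfP]
    linarith
  -- `‖Df(Q) + Df(P)‖ ≤ Kc√2ρ`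
  have hDQ : fderiv ℝ f (WithLp.toLp 2 (u θ • dir θ - wv)) = -fderiv ℝ f (WithLp.toLp 2 (p - e)) := by
    rw [hq, hf, fderiv_frameLevel_toLp_reflect]
  have hγ : ‖fderiv ℝ f (WithLp.toLp 2 (u θ • dir θ - wv)) + fderiv ℝ f P‖ ≤ Kc * (Real.sqrt 2 * ρ) := by
    rw [hDQ, hPE, neg_add_eq_sub]
    have h1 := norm_fderiv_frameLevel_sub_le hG (P - E) P
    rw [show P - (P - E) = E by abel] at h1
    exact h1.trans (mul_le_mul_of_nonneg_left hEn hKc)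
  -- the abstract bound
  have hmain := caustic_second_variation_ge hG hPV hfloorP hid hQ hγ
  have e2 : 2 * w * ‖V‖ ^ 2 = 2 * w * (VXE u θ ^ 2 + VYE u θ ^ 2) := by rw [hV2]
  rw [e2] at hmain
  exact hmain

omit hκ hκ₁ hG hν in
/-- **The acceleration vector of the curve is bounded by `|u″| + 2|u′| + u`** (`a = u″·dir θ + 2u′·dir(θ + π/2) − u·dir θ`, `‖toLp dir‖ = 1`). [folklore] -/
theorem norm_toLp_accel_le (θ : ℝ) :
    ‖(WithLp.toLp 2 ![deriv (deriv u) θ * Real.cos θ - 2 * deriv u θ * Real.sin θ - u θ * Real.cos θ,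
        deriv (deriv u) θ * Real.sin θ + 2 * deriv u θ * Real.cos θ - u θ * Real.sin θ] : Momentum)‖ ≤
      |deriv (deriv u) θ| + 2 * |deriv u θ| + u θ := by
  have hupos : 0 < u θ := (mem_Ioo_of_shifted B hδ hlo hhi (hu θ)).1
  have hdir : ∀ φ : ℝ, ‖(WithLp.toLp 2 (dir φ) : Momentum)‖ = 1 := fun φ => by
    rw [EuclideanSpace.norm_eq, Fin.sum_univ_two]
    simp only [dir, Real.norm_eq_abs, sq_abs, Matrix.cons_val_zero, Matrix.cons_val_one]
    rw [Real.cos_sq_add_sin_sq, Real.sqrt_one]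
  rw [acceleration_eq u θ, WithLp.toLp_sub, WithLp.toLp_add, WithLp.toLp_smul, WithLp.toLp_smul, WithLp.toLp_smul]
  calc ‖deriv (deriv u) θ • (WithLp.toLp 2 (dir θ) : Momentum) + (2 * deriv u θ) • WithLp.toLp 2 (dir (θ + π / 2)) -
          u θ • WithLp.toLp 2 (dir θ)‖
        ≤ ‖deriv (deriv u) θ • (WithLp.toLp 2 (dir θ) : Momentum) + (2 * deriv u θ) • WithLp.toLp 2 (dir (θ + π / 2))‖ +
          ‖u θ • (WithLp.toLp 2 (dir θ) : Momentum)‖ := norm_sub_le _ _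
    _ ≤ ‖deriv (deriv u) θ • (WithLp.toLp 2 (dir θ) : Momentum)‖ + ‖(2 * deriv u θ) • (WithLp.toLp 2 (dir (θ + π / 2)) : Momentum)‖ +
          ‖u θ • (WithLp.toLp 2 (dir θ) : Momentum)‖ := by gcongr; exact norm_add_le _ _
    _ = |deriv (deriv u) θ| + 2 * |deriv u θ| + u θ := by
          rw [norm_smul, norm_smul, norm_smul, hdir, hdir, Real.norm_eq_abs, Real.norm_eq_abs, Real.norm_eq_abs,
            abs_mul, abs_two, abs_of_pos hupos]
          ring

omit hν in
/-- **`N`-uniform acceleration bound on the frame curve**: `|u″| ≤ (2Kc·S_E² + (8 + 2κ₁)U₁ + (4 + κ₁)π√2)/(Dt_min − κ₁)` with `S_E` the speed bound of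
`abs_VXE_le` and `U₁ = (4 + κ₁)π√2/(Dt_min − κ₁)` — p4's `abs_second_deriv_le` with the `C²` size of `δ_K` replaced by the GLOBAL `‖D²e_K‖ ≤ Kc` of `GeomConstants`
(the Hessian term of `radial_second_deriv_identity` is `D²e_K(P)[V,V]`). [cite: BenfattoGiulianiMastropietro2006, §2.4 Lemma 2.1 (2.41)] -/
theorem abs_second_deriv_le_of_geomConstants (θ : ℝ) :
    |deriv (deriv u) θ| ≤
      (2 * Kc * (B.smax + κ₁ * (π * Real.sqrt 2 + 2 * B.smax) / (B.Dtmin - κ₁)) ^ 2 +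
        (8 + 2 * κ₁) * ((4 + κ₁) * (π * Real.sqrt 2) / (B.Dtmin - κ₁)) + (4 + κ₁) * (π * Real.sqrt 2)) / (B.Dtmin - κ₁) := by
  set f := frameLevel μ K with hf
  set SE := B.smax + κ₁ * (π * Real.sqrt 2 + 2 * B.smax) / (B.Dtmin - κ₁) with hSE
  set U1 := (4 + κ₁) * (π * Real.sqrt 2) / (B.Dtmin - κ₁) with hU1
  have hδs : ContDiff ℝ 2 (fun k : Fin 2 → ℝ => -K.eval k) := contDiff_frameShift_toLp K
  have h2ne : (2 : WithTop ℕ∞) ≠ 0 := by norm_num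
  have hu2 : ContDiff ℝ 2 u := contDiff_of_isRoot B hδs h2ne hδ hlo hhi hκ hκ₁ hu
  have hroot : ∀ ϑ, sqDispersion (u ϑ • dir ϑ) + (fun k : Fin 2 → ℝ => -K.eval k) (u ϑ • dir ϑ) = ν := fun ϑ =>
    ((isBandFermiRadius_shifted_iff (fun k : Fin 2 → ℝ => -K.eval k) ν ϑ (u ϑ)).1 (hu ϑ)).2
  have hsq := abs_apply_le_pi_of_isBandFermiRadius (hu θ)
  have hden : 0 < B.Dtmin - κ₁ := sub_pos.2 hκ₁
  have hKc : 0 ≤ Kc := le_trans (norm_nonneg _) (hG.norm_iteratedFDeriv_le (WithLp.toLp 2 (u θ • dir θ)) 0 (by norm_num))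
  obtain ⟨hvx, hvy⟩ := abs_VXE_le B hδs h2ne hδ hlo hhi hκ hκ₁ hu θ
  have hupos : 0 < u θ := (mem_Ioo_of_shifted B hδ hlo hhi (hu θ)).1
  have hule : u θ ≤ π * Real.sqrt 2 := root_le_pi_mul_sqrt_two B hδ hlo hhi hu θ
  have hκ₁0 : 0 ≤ κ₁ := le_trans (norm_nonneg _) (hκ _ hsq)
  have hSE0 : 0 ≤ SE := (abs_nonneg _).trans hvx
  have hu1 : |deriv u θ| ≤ U1 := by
    have h := abs_deriv_le B hδs h2ne hδ hlo hhi hκ hκ₁ hu θ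
    refine h.trans ?_
    rw [hU1]
    refine div_le_div_of_nonneg_right ?_ hden.le
    exact mul_le_mul_of_nonneg_left hule (by linarith only [hκ₁0])
  -- the identity
  have hid := radial_second_deriv_identity hδs hu2 hroot θ
  -- the Hessian term is `D²e_K(P)[V,V]`, bounded by `Kc‖V‖² ≤ 2Kc·S_E²`
  have hx0 : (u θ • dir θ) 0 = XE u θ := by simp [dir, XE]
  have hx1 : (u θ • dir θ) 1 = YE u θ := by simp [dir, YE]
  have hHess : fderiv ℝ (fderiv ℝ f) (WithLp.toLp 2 (u θ • dir θ)) (WithLp.toLp 2 ![VXE u θ, VYE u θ]) (WithLp.toLp 2 ![VXE u θ, VYE u θ]) =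
      2 * Real.cos (XE u θ) * VXE u θ ^ 2 + 2 * Real.cos (YE u θ) * VYE u θ ^ 2 +
        fderiv ℝ (fderiv ℝ (fun k : Fin 2 → ℝ => -K.eval k)) (u θ • dir θ) ![VXE u θ, VYE u θ] ![VXE u θ, VYE u θ] := by
    have h := hessQuad_frameLevel_toLp μ K (u θ • dir θ) ![VXE u θ, VYE u θ]
    rw [hessQuad, iteratedFDeriv_two_apply, hx0, hx1] at h
    simpa only [Matrix.cons_val_zero, Matrix.cons_val_one] using h
  have hV2 : ‖(WithLp.toLp 2 ![VXE u θ, VYE u θ] : Momentum)‖ ^ 2 = VXE u θ ^ 2 + VYE u θ ^ 2 := by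
    rw [EuclideanSpace.norm_eq, Real.sq_sqrt (Finset.sum_nonneg fun i _ => sq_nonneg _), Fin.sum_univ_two]
    simp only [Real.norm_eq_abs, sq_abs, Matrix.cons_val_zero, Matrix.cons_val_one]
  have hB2 : |2 * Real.cos (XE u θ) * VXE u θ ^ 2 + 2 * Real.cos (YE u θ) * VYE u θ ^ 2 +
        fderiv ℝ (fderiv ℝ (fun k : Fin 2 → ℝ => -K.eval k)) (u θ • dir θ) ![VXE u θ, VYE u θ] ![VXE u θ, VYE u θ]| ≤
      Kc * (2 * SE ^ 2) := by
    rw [← hHess]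
    have hn : ‖fderiv ℝ (fderiv ℝ f) (WithLp.toLp 2 (u θ • dir θ))‖ ≤ Kc := by
      rw [← norm_iteratedFDeriv_one (𝕜 := ℝ) (f := fderiv ℝ f), norm_iteratedFDeriv_fderiv]
      exact hG.norm_iteratedFDeriv_le _ 2 le_rfl
    rw [← Real.norm_eq_abs]
    calc ‖fderiv ℝ (fderiv ℝ f) (WithLp.toLp 2 (u θ • dir θ)) (WithLp.toLp 2 ![VXE u θ, VYE u θ]) (WithLp.toLp 2 ![VXE u θ, VYE u θ])‖
        ≤ ‖fderiv ℝ (fderiv ℝ f) (WithLp.toLp 2 (u θ • dir θ)) (WithLp.toLp 2 ![VXE u θ, VYE u θ])‖ *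
            ‖(WithLp.toLp 2 ![VXE u θ, VYE u θ] : Momentum)‖ := ContinuousLinearMap.le_opNorm _ _
      _ ≤ ‖fderiv ℝ (fderiv ℝ f) (WithLp.toLp 2 (u θ • dir θ))‖ * ‖(WithLp.toLp 2 ![VXE u θ, VYE u θ] : Momentum)‖ *
            ‖(WithLp.toLp 2 ![VXE u θ, VYE u θ] : Momentum)‖ := by
          gcongr; exact ContinuousLinearMap.le_opNorm _ _
      _ ≤ Kc * ‖(WithLp.toLp 2 ![VXE u θ, VYE u θ] : Momentum)‖ * ‖(WithLp.toLp 2 ![VXE u θ, VYE u θ] : Momentum)‖ := by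
          gcongr
      _ = Kc * (VXE u θ ^ 2 + VYE u θ ^ 2) := by rw [mul_assoc, ← sq, hV2]
      _ ≤ Kc * (2 * SE ^ 2) := by
          refine mul_le_mul_of_nonneg_left ?_ hKc
          have h1 : VXE u θ ^ 2 ≤ SE ^ 2 := by rw [← sq_abs]; exact pow_le_pow_left₀ (abs_nonneg _) hvx 2
          have h2 : VYE u θ ^ 2 ≤ SE ^ 2 := by rw [← sq_abs]; exact pow_le_pow_left₀ (abs_nonneg _) hvy 2
          linarith
  -- the other terms
  have hDt := abs_rayDispersionDt_le_four θ (u θ)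
  have hddir : |fderiv ℝ (fun k : Fin 2 → ℝ => -K.eval k) (u θ • dir θ) (dir θ)| ≤ κ₁ := abs_fderiv_dir_le (hκ _ hsq) θ
  have hddir' : |fderiv ℝ (fun k : Fin 2 → ℝ => -K.eval k) (u θ • dir θ) (dir (θ + π / 2))| ≤ κ₁ :=
    abs_fderiv_dir_le (hκ _ hsq) (θ + π / 2)
  have hpert : B.Dtmin - κ₁ ≤ rayDispersionDt θ (u θ) + fderiv ℝ (fun k : Fin 2 → ℝ => -K.eval k) (u θ • dir θ) (dir θ) :=
    Dtmin_sub_le_pertDt B hδ hlo hhi hκ hu θ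
  have htrig : |Real.sin (XE u θ) * Real.sin θ - Real.sin (YE u θ) * Real.cos θ| ≤ 2 := by
    have h1 : |Real.sin (XE u θ) * Real.sin θ| ≤ 1 := by
      rw [abs_mul]
      calc |Real.sin (XE u θ)| * |Real.sin θ| ≤ 1 * 1 :=
            mul_le_mul (Real.abs_sin_le_one _) (Real.abs_sin_le_one _) (abs_nonneg _) zero_le_one
        _ = 1 := one_mul 1
    have h2 : |Real.sin (YE u θ) * Real.cos θ| ≤ 1 := by
      rw [abs_mul]
      calc |Real.sin (YE u θ)| * |Real.cos θ| ≤ 1 * 1 :=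
            mul_le_mul (Real.abs_sin_le_one _) (Real.abs_cos_le_one _) (abs_nonneg _) zero_le_one
        _ = 1 := one_mul 1
    have h3 := abs_sub (Real.sin (XE u θ) * Real.sin θ) (Real.sin (YE u θ) * Real.cos θ)
    linarith only [h1, h2, h3]
  have t2 : |4 * deriv u θ * (Real.sin (XE u θ) * Real.sin θ - Real.sin (YE u θ) * Real.cos θ)| ≤ 8 * |deriv u θ| := by
    rw [abs_mul, abs_mul, abs_of_pos (by norm_num : (0:ℝ) < 4)]
    have h := mul_le_mul_of_nonneg_left htrig (abs_nonneg (deriv u θ))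
    linarith only [h]
  have t3 : |u θ * rayDispersionDt θ (u θ)| ≤ 4 * u θ := by
    rw [abs_mul, abs_of_pos hupos]
    have h := mul_le_mul_of_nonneg_left hDt hupos.le
    linarith only [h]
  have t4 : |2 * deriv u θ * fderiv ℝ (fun k : Fin 2 → ℝ => -K.eval k) (u θ • dir θ) (dir (θ + π / 2))| ≤ 2 * κ₁ * |deriv u θ| := by
    rw [abs_mul, abs_mul, abs_two]
    have h := mul_le_mul_of_nonneg_left hddir' (abs_nonneg (deriv u θ))
    linarith only [h]
  have t5 : |u θ * fderiv ℝ (fun k : Fin 2 → ℝ => -K.eval k) (u θ • dir θ) (dir θ)| ≤ κ₁ * u θ := by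
    rw [abs_mul, abs_of_pos hupos]
    have h := mul_le_mul_of_nonneg_left hddir hupos.le
    linarith only [h]
  -- `|RHS| ≤ 2Kc S_E² + (8 + 2κ₁)|u′| + (4 + κ₁)u`
  have hR : |(rayDispersionDt θ (u θ) + fderiv ℝ (fun k : Fin 2 → ℝ => -K.eval k) (u θ • dir θ) (dir θ)) * deriv (deriv u) θ| ≤
      Kc * (2 * SE ^ 2) + (8 + 2 * κ₁) * |deriv u θ| + (4 + κ₁) * u θ := by
    rw [hid]
    have key : ∀ (H X2 X3 X4 X5 bH b2 b3 b4 b5 : ℝ), |H| ≤ bH → |X2| ≤ b2 → |X3| ≤ b3 → |X4| ≤ b4 → |X5| ≤ b5 →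
        |-H + X2 + X3 - X4 + X5| ≤ bH + b2 + b3 + b4 + b5 := by
      intro H X2 X3 X4 X5 bH b2 b3 b4 b5 h1 h2 h3 h4 h5
      have e1 := abs_add_le (-H + X2 + X3 - X4) X5
      have e2 := abs_sub (-H + X2 + X3) X4
      have e3 := abs_add_le (-H + X2) X3
      have e4 := abs_add_le (-H) X2
      rw [abs_neg] at e4
      linarith only [e1, e2, e3, e4, h1, h2, h3, h4, h5]
    refine (key _ _ _ _ _ _ _ _ _ _ hB2 t2 t3 t4 t5).trans (le_of_eq ?_)
    ring
  -- divide by the radial transversality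
  have hc0 : 0 < rayDispersionDt θ (u θ) + fderiv ℝ (fun k : Fin 2 → ℝ => -K.eval k) (u θ • dir θ) (dir θ) := hden.trans_le hpert
  rw [abs_mul, abs_of_pos hc0] at hR
  rw [le_div_iff₀ hden]
  have hnum : Kc * (2 * SE ^ 2) + (8 + 2 * κ₁) * |deriv u θ| + (4 + κ₁) * u θ ≤
      2 * Kc * SE ^ 2 + (8 + 2 * κ₁) * U1 + (4 + κ₁) * (π * Real.sqrt 2) := by
    have h1 : (8 + 2 * κ₁) * |deriv u θ| ≤ (8 + 2 * κ₁) * U1 := mul_le_mul_of_nonneg_left hu1 (by linarith only [hκ₁0])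
    have h2 : (4 + κ₁) * u θ ≤ (4 + κ₁) * (π * Real.sqrt 2) := mul_le_mul_of_nonneg_left hule (by linarith only [hκ₁0])
    linarith only [h1, h2]
  calc |deriv (deriv u) θ| * (B.Dtmin - κ₁)
      ≤ |deriv (deriv u) θ| * (rayDispersionDt θ (u θ) + fderiv ℝ (fun k : Fin 2 → ℝ => -K.eval k) (u θ • dir θ) (dir θ)) :=
        mul_le_mul_of_nonneg_left hpert (abs_nonneg _)
    _ = (rayDispersionDt θ (u θ) + fderiv ℝ (fun k : Fin 2 → ℝ => -K.eval k) (u θ • dir θ) (dir θ)) * |deriv (deriv u) θ| := by ring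
    _ ≤ _ := hR.trans hnum

end Root

end Summit.HubbardSuperconductivity.HubbardSuperconductivity.Theorems.PerturbedFermiCurve

end
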